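import Literature.MathematicalPhysics.QuantumFieldTheory.Balaban1983to89.B13TermKernelsPullback

/-!
# `Balaban1983to89.B13WindowKernels` — T. Bałaban, *Renormalization group approach to lattice gauge field theories. I*,
Commun. Math. Phys. **109** (1987) 249–301 [Balaban1987RG1], (1.7) p. 261, (1.18) p. 263, (1.21) p. 264 («This limit exists by
the localized representation (1.7)»), with *II. Cluster expansions*, CMP **116** (1988) [Balaban1988RG2Cluster], p. 13,
(2.14)–(2.16) pp. 15–16, and [B9] CMP **99** (1985) [Balaban1985BackgroundPropagators], Thm 3.10 p. 416: **TORUS-FREE KERNEL DATA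
OF A TERM AT A FIXED DOMAIN («window kernels») AND THEIR PLACEMENTS ON THE TORI OF THE EXHAUSTING SEQUENCE — THE ACROSS-TORI
IDENTITY OF THE RESTRICTED ENTRIES IS DEFINITIONAL, WITH ONE TORUS-INDEPENDENT LOCAL FACTOR FOR EVERY JET OBJECT**

statement-level skeleton of published theorems with citation tags; proofs where landed; nothing here is a claim about
the Yang–Mills mass gap

CITATION HEADER.  Cell `pub-balaban`, BINDER row (D4) OWNER lineage `b2b-balaban-beta-an4` (gen 119), second objects-side
junction of the generation for the ideation cell `ym-nodeO-ideate`'s road «W-jet2» (P3 memo `ROUTE-P3.md` v3.30 §21 (E); P3 g24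
evidence rows 50 ∕ 52 on `stmt-QuantumFields-19181` = `NodeO-jet-entrylocal-v2∕v3-P3g24.lean`, 2026-08-26T10:56Z ∕ 11:11Z; P3's
pointers «cc beta-an4 successor» on the pub-ymgap bus l.11724 ∕ l.11740 and its HANDOFF OPEN item (d) «beta-an4 successor's
reaction … if they type (r1∞)∕(r2∞) against `EntryLocalTower`, record by name; if they choose another shape, compare»).  P3's
(r2∞) `EntryLocalTower 𝒦 σ e r ρ ρ'` asks, for a TOWER of terms `𝒦 n : TermKernels c d (N' n) (ν n) (Nf n) (W n)` (torus `n`,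
configuration space `W n`, tree parameters `σ n`), ONE window space `V`, ONE restricted-entry function `Er : V → ι → ℂ` on a
COMMON index `ι` (reindexings `e n`), restrictions `r n : W n →L[ℂ] V`, holomorphy of `Er` on a ball, and EVENTUALLY in `n`
`entries (𝒦 n) (σ n) u (e n i) = Er (r n u) i` on a ball — «the across-family content is IDENTITY across tori (locality proper:
the same function for every torus containing X), not a letter» — and consumes it in `wallShapes_tower` (ONE `F`, analytic at `0`,
with `Obj n u = F (r n u)` eventually in `n`: the `(V Y, F Y, r n Y, hF, hfac)` fields of the (D4) wall
`Beta.RemainderLocality.PolLeavesTFac`).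
THE PRINT.  [I] p. 261 (1.7) *"the term corresponding to a domain X depends on U_j restricted to X"*; p. 264 (1.21): the
infinite-volume coefficients are limits over the tori, *"This limit exists by the localized representation (1.7)"* — i.e. the
localized term at a fixed domain `X` is ONE function of the configuration on `X`, the same for every torus of the sequence
containing `X` (the operators of the term are built on `X` with the decoupling of [II] p. 13 and do not see the torus); [II]
p. 13: the operators of the term `(𝐃, P)` depend on the decoupling parameters `s` of the cubes of `𝐃` only.  This lineage's
`B13TermKernelsPullback` (p441835) typed the single-torus half (kernel data on the window space read through one restriction);
across tori the tree's `TermKernels c d N' ν Nf V` cannot serve as the common window object — it carries ONE torus's bookkeeping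
(`σ : TPt d N' → ℂ`, locations in `UT Nf`).  This file removes the torus from the window object.

WHAT THIS FILE TYPES ∕ PROVES ([folklore] bookkeeping; kernel-checked).
§1 `WindowKernels J V` — DATA, torus-free: rows `Λ`, extra columns `C₀`, the precision `A(τ, v)` and Γ-kernel `G(τ, v)` as
   functions of the LOCAL tree parameters `τ : J → ℂ` (`J` = the parameter-carrying cubes of the term's domain) and of the window
   configuration `v : V`, the real reference data `Γ₀ = G(0,0)`, `C = A(0,0)⁻¹ ≻ 0`, the fibre bound `m`; `wentries 𝒲 τ v` = its
   entries as one point of `ℂ^ι`, `ι = (Λ × (Λ ⊕ C₀)) ⊕ (Λ × Λ)` — ONE index type for every torus; `HolBddOn 𝒲 τ R S` = the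
   torus-free holomorphy ∕ bound letter of the entries on the `R`-ball of `V` (hypothesis shape).
§2 `Placement 𝒲 d N' ν Nf W` — DATA: how the window object sits in torus `(N', ν, Nf)` with full configuration space `W`: the
   embedding `ιJ : J → TPt d N'` of the local parameter index into the torus's tree-parameter sites, the restriction `r : W →L[ℂ] V`,
   the bond locations `locΛ`, `locN`, the σ-region `X` and the fibre count; `place c 𝒲 P : TermKernels c d N' ν Nf W` — the term's
   kernel data on that torus (`A(σ,u) := A_𝒲(σ ∘ ιJ, r u)`, `G(σ,u) := G_𝒲(σ ∘ ιJ, r u)`); `entries_place` (rfl); `Placement.window`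
   (same bookkeeping, `W := V`, `r := id`) and `place_eq_pullback : place c 𝒲 P = pullback (place c 𝒲 P.window) P.r` (rfl) — so every
   lemma of `B13TermKernelsPullback` applies to placed kernels (`termWalkData_place`: walk data at the window placement + a
   contraction ⟹ walk data at the placement, same package).
§3 ACROSS TORI: for placements `P n` of ONE window object on the tori `n` of a sequence (`N' n, ν n, Nf n, W n` arbitrary) and
   tree parameters `σ n` whose LOCAL parts agree, `σ n ((P n).ιJ j) = τ j`: **`entries_place_tower`** —
   `entries (place c 𝒲 (P n)) (σ n) u = wentries 𝒲 τ ((P n).r u)` for EVERY `n` and EVERY `u : W n` (P3's `EntryLocalTower`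
   factorisation clause with `Er := wentries 𝒲 τ`, `e n := Equiv.refl _`, not only eventually and not only on a ball);
   `holBddOn_of_termWalkData` — the holomorphy ∕ bound clause from the walk objects of the term AT ONE WINDOW PLACEMENT (any one
   torus's bookkeeping, `r = id`) with `S = max K̄_Γ K̄_E`; **`wallShapes_tower_place`** — from `HolBddOn 𝒲 τ R S` (`R > 0`, `V`
   finite-dimensional, `C₀` finite) and ONE `Φ` holomorphic on an open set containing `wentries 𝒲 τ 0`: ONE `F : V → T`, analytic
   at `0`, with `Φ (entries (kjet (place c 𝒲 (P n))) (σ n) u) = F ((P n).r u)` for EVERY `n` and `u` — the conclusion of P3's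
   `wallShapes_tower` for the jet objects of a placed tower, `∀ n` in place of `∀ᶠ n`, explicit witness
   `F = Φ ∘ (v ↦ (jet2 (wentries 𝒲 τ · i) v)_i)`; `wallShapes_tower_place_of_termWalkData` (the same from walk data at one window
   placement with an admissible package).
READING (planning-grade, for P3's §21 (E) and for NODE 00's term tower of record): a producer who presents Bałaban's term at
domain `X` as ONE `WindowKernels` object placed on each torus of the exhausting sequence meets (r2∞) — the across-tori
IDENTITY the (D4) wall consumes — BY CONSTRUCTION, for all `n`; what does NOT transport across tori are the torus-metric
statements (walk majorants in `tdist1`, `hfar`, `through X`: one `TermWalkData (place c 𝒲 (P n)) w` per torus, with ONE package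
`w` = the uniform statement (v) of `B13TermWalkData`), exactly P3's «identity, not letters».  (r1∞) — that the wall's object at
torus `n` is ONE `Φ` of the placed jet entries — is the term-tower bookkeeping, a hypothesis here as there.
HONEST SCOPE.  Two DATA records (`WindowKernels`, `Placement`), three plumbing defs (`wentries`, `place`, `Placement.window`), one
hypothesis shape (`HolBddOn`) + [folklore] lemmas over the tree's `TermKernels` ∕ `TermWalkData` ∕ `kjet` ∕ `entries` ∕ `jet2` and
this lineage's `pullback`; NOT asserted: that Bałaban's `Γ_k(Z₀,σ)`, `Δ^{(k)}(Z₀,σ)`, `C^{(k)}(Z₀,σ)` at a domain ARE torus-free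
window objects with walk data (NODE O ∕ NODE 00 content: the decoupled random-walk expansions of [II] p. 13 ∕ [B9] Thm 3.10 in a
complex background, cell GAPS G-B9-10), nor any constant; no object of Bałaban's is constructed; row (D4) instance 0∕1, T⁴ spine
0∕9 UNCHANGED; NOT NODE O, NOT [B12] Thm 2, NOT `BetaPertH`, NOT continuum, NOT mass gap, NOT Clay.  No `sorry`, no named fact,
no `instance` and no instance attribute (the window object's `Fintype`∕`DecidableEq` fields are passed explicitly to `TermKernels`), no notation.  HONEST DEPENDENCY
(cell pub-balaban, verbatim): continuum YM on T⁴ ⇐ BetaPertH ∧ nine spine estimates (0∕9 proved); BetaPertH ⇐ (D1) ∧ (D4) ∧ CAP+tail.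
-/

noncomputable section

namespace Literature.MathematicalPhysics.QuantumFieldTheory.Balaban1983to89.B13WindowKernels

open Metric Set Filter
open scoped Topology
open B13TermWalkData (TermKernels WalkConsts TermWalkData)
open TreeLengthTorus (TPt)
open B5TorusCover (UT)
open NodeOJetCalculus (jet2)
open NodeOJetFamily (kjet entries)
open B13JetFamilyLocality (entries_kjet_fac analyticAt_jetFactor)
open B13TermKernelsPullback (pullback termWalkData_pullback_of_opNorm_le termWalkData_differentiableOn_entries
  termWalkData_norm_entries_le)

/-! ## §1 Torus-free kernel data of a term at a fixed domain -/

section Window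

/-- **WINDOW KERNELS** — the kernel data of one (2.14)-term at a FIXED localization domain, with NO torus bookkeeping: rows
`Λ` (bonds of `Z₀`), extra columns `C₀`, the joint precision `A(τ, v)` and Γ-kernel `G(τ, v)` as functions of the local tree
parameters `τ : J → ℂ` (on the parameter-carrying cubes `J` of the domain) and of the window configuration `v : V`
(configurations on the domain), the real reference values `Γ₀ = G(0,0)`, `C = A(0,0)⁻¹ ≻ 0`, and the fibre bound `m`.  Print:
the term's operators are built on the domain with the decoupling of the cubes outside it and depend on the configuration
restricted to the domain — the same object for every torus containing it.  DATA; nothing asserted.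
[cite: Balaban1987RG1, (1.7) p.261, (1.18) p.263, (1.21) p.264; Balaban1988RG2Cluster, p.13, (2.14)–(2.16) pp.15–16] -/
structure WindowKernels (J : Type) (V : Type*) [NormedAddCommGroup V] [NormedSpace ℂ V] where
  Λ : Type
  [instFintype : Fintype Λ]
  [instDecEq : DecidableEq Λ]
  C₀ : Type
  A2 : (J → ℂ) → V → Matrix Λ Λ ℂ
  G2 : (J → ℂ) → V → Matrix Λ (Λ ⊕ C₀) ℂ
  Γ₀ : Matrix Λ (Λ ⊕ C₀) ℝ
  C : Matrix Λ Λ ℝ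
  m : ℕ
  hG0 : G2 0 0 = Γ₀.map (algebraMap ℝ ℂ)
  hC0 : (A2 0 0)⁻¹ = C.map (algebraMap ℝ ℂ)
  hC : C.PosDef

variable {J : Type} {V : Type*} [NormedAddCommGroup V] [NormedSpace ℂ V]

/-- The entries of a window object at local parameter `τ` and window configuration `v`, as one point of `ℂ^ι`,
`ι = (Λ × (Λ ⊕ C₀)) ⊕ (Λ × Λ)` — ONE index type for every torus (the idiom of `NodeOJetFamily.entries`). DATA.
[cite: Balaban1988RG2Cluster, (2.14)–(2.16) pp.15–16] -/
def wentries (𝒲 : WindowKernels J V) (τ : J → ℂ) (v : V) : (𝒲.Λ × (𝒲.Λ ⊕ 𝒲.C₀)) ⊕ (𝒲.Λ × 𝒲.Λ) → ℂ :=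
  Sum.elim (fun p => 𝒲.G2 τ v p.1 p.2) (fun p => 𝒲.A2 τ v p.1 p.2)

/-- **The torus-free holomorphy ∕ bound letter of the window entries** at local parameter `τ` on the `R`-ball of `V`
(hypothesis shape = the `hEr` ∕ `hbd` clauses of `B13JetFamilyLocality`, stated ONCE for all tori; print p. 15: analytic on
the bigger space with constants `α′₀, α′₁`). [cite: Balaban1988RG2Cluster, p.15; Balaban1987RG1, (1.18) p.263] -/
def HolBddOn (𝒲 : WindowKernels J V) (τ : J → ℂ) (R S : ℝ) : Prop :=
  (∀ i, DifferentiableOn ℂ (fun v => wentries 𝒲 τ v i) (ball 0 R)) ∧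
    ∀ i, ∀ v ∈ ball (0 : V) R, ‖wentries 𝒲 τ v i‖ ≤ S

/-- Monotonicity of the letter (smaller ball, larger bound). [cite: Balaban1988RG2Cluster, p.15] -/
theorem HolBddOn.mono {𝒲 : WindowKernels J V} {τ : J → ℂ} {R S R' S' : ℝ} (h : HolBddOn 𝒲 τ R S) (hR : R' ≤ R)
    (hS : S ≤ S') : HolBddOn 𝒲 τ R' S' :=
  ⟨fun i => (h.1 i).mono (ball_subset_ball hR), fun i v hv => (h.2 i v (ball_subset_ball hR hv)).trans hS⟩

end Window

/-! ## §2 Placements of a window object on a torus; the placed term kernels; the link with `pullback` -/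

section Place

variable {J : Type} {V : Type*} [NormedAddCommGroup V] [NormedSpace ℂ V]

/-- **PLACEMENT of a window object on the torus `(N', ν, Nf)` with full configuration space `W`**: the embedding `ιJ` of the
local parameter index into the torus's tree-parameter sites, the restriction `r : W →L[ℂ] V` (window map), the bond locations
on the site torus, the σ-region `X` (the cubes of `σ₀` outside `Z̃₀`, print p. 13) and the fibre count (`≤ m` row bonds per
site).  DATA; nothing asserted. [cite: Balaban1988RG2Cluster, p.13, (2.14)–(2.16) pp.15–16; Balaban1987RG1, (1.7) p.261] -/
structure Placement (𝒲 : WindowKernels J V) (d N' ν : ℕ) (Nf : Fin ν → ℕ) [∀ i, NeZero (Nf i)]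
    (W : Type*) [NormedAddCommGroup W] [NormedSpace ℂ W] where
  ιJ : J → TPt d N'
  r : W →L[ℂ] V
  locΛ : 𝒲.Λ → UT Nf
  locN : 𝒲.Λ ⊕ 𝒲.C₀ → UT Nf
  X : Finset (UT Nf)
  hfib : ∀ x : UT Nf, ((@Finset.univ 𝒲.Λ 𝒲.instFintype).filter fun i => locΛ i = x).card ≤ 𝒲.m

variable {d N' ν : ℕ} {Nf : Fin ν → ℕ} [∀ i, NeZero (Nf i)]
variable {W : Type*} [NormedAddCommGroup W] [NormedSpace ℂ W]

/-- **THE PLACED TERM KERNELS**: the kernel data of the term on the torus, read from the window object through the placement —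
`A(σ,u) := A_𝒲(σ ∘ ιJ, r u)`, `G(σ,u) := G_𝒲(σ ∘ ιJ, r u)` (the kernels see the tree parameters of the domain's own cubes and
the configuration on the domain, nothing else); rows, columns, reference data and fibre bound are the window object's,
locations and σ-region the placement's. DATA. [cite: Balaban1987RG1, (1.7) p.261, (1.18) p.263; Balaban1988RG2Cluster, p.13, (2.14)–(2.16) pp.15–16] -/
def place (c : B13.Consts) (𝒲 : WindowKernels J V) (P : Placement 𝒲 d N' ν Nf W) : TermKernels c d N' ν Nf W where
  Λ := 𝒲.Λ
  instFintype := 𝒲.instFintype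
  instDecEq := 𝒲.instDecEq
  C₀ := 𝒲.C₀
  A2 := fun σ u => 𝒲.A2 (fun j => σ (P.ιJ j)) (P.r u)
  G2 := fun σ u => 𝒲.G2 (fun j => σ (P.ιJ j)) (P.r u)
  Γ₀ := 𝒲.Γ₀
  C := 𝒲.C
  locΛ := P.locΛ
  locN := P.locN
  X := P.X
  m := 𝒲.m
  hfib := P.hfib
  hG0 := by
    show 𝒲.G2 0 (P.r 0) = _
    rw [map_zero]; exact 𝒲.hG0
  hC0 := by
    letI : Fintype 𝒲.Λ := 𝒲.instFintype; letI : DecidableEq 𝒲.Λ := 𝒲.instDecEq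
    show (𝒲.A2 0 (P.r 0))⁻¹ = _
    rw [map_zero]; exact 𝒲.hC0
  hC := 𝒲.hC

variable {c : B13.Consts}

/-- The placed precision (definitional). [cite: Balaban1988RG2Cluster, (2.14)–(2.16) pp.15–16] -/
@[simp] theorem place_A2 (𝒲 : WindowKernels J V) (P : Placement 𝒲 d N' ν Nf W) (σ : TPt d N' → ℂ) (u : W) :
    (place c 𝒲 P).A2 σ u = 𝒲.A2 (fun j => σ (P.ιJ j)) (P.r u) := rfl

/-- The placed Γ-kernel (definitional). [cite: Balaban1988RG2Cluster, (2.14)–(2.16) pp.15–16] -/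
@[simp] theorem place_G2 (𝒲 : WindowKernels J V) (P : Placement 𝒲 d N' ν Nf W) (σ : TPt d N' → ℂ) (u : W) :
    (place c 𝒲 P).G2 σ u = 𝒲.G2 (fun j => σ (P.ιJ j)) (P.r u) := rfl

/-- **The entries of the placed kernels are the window entries at the local parameters, read through the restriction**
(`rfl`). [cite: Balaban1987RG1, (1.7) p.261; Balaban1988RG2Cluster, (2.14)–(2.16) pp.15–16] -/
theorem entries_place (𝒲 : WindowKernels J V) (P : Placement 𝒲 d N' ν Nf W) (σ : TPt d N' → ℂ) (u : W) :
    entries (place c 𝒲 P) σ u = wentries 𝒲 (fun j => σ (P.ιJ j)) (P.r u) := rfl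

/-- **The WINDOW placement**: the same torus bookkeeping with the window space as its own configuration space (`r := id`).
DATA. [cite: Balaban1987RG1, (1.7) p.261] -/
def Placement.window {𝒲 : WindowKernels J V} (P : Placement 𝒲 d N' ν Nf W) : Placement 𝒲 d N' ν Nf V where
  ιJ := P.ιJ
  r := ContinuousLinearMap.id ℂ V
  locΛ := P.locΛ
  locN := P.locN
  X := P.X
  hfib := P.hfib

/-- **A placed term IS the pullback of its window placement along its restriction** (`rfl`) — so every transport ∕ locality
lemma of `B13TermKernelsPullback` applies to placed kernels. [cite: Balaban1987RG1, (1.7) p.261; Balaban1988RG2Cluster, p.13] -/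
theorem place_eq_pullback (𝒲 : WindowKernels J V) (P : Placement 𝒲 d N' ν Nf W) :
    place c 𝒲 P = pullback (place c 𝒲 P.window) P.r := rfl

/-- Hence: **walk data at the window placement with one package transport to the placement along a contraction, SAME
package** (`B13TermKernelsPullback.termWalkData_pullback_of_opNorm_le`). [cite: Balaban1988RG2Cluster, p.13, p.15; Balaban1985BackgroundPropagators, Thm 3.10 p.416] -/
theorem termWalkData_place {𝒲 : WindowKernels J V} {P : Placement 𝒲 d N' ν Nf W} {w : WalkConsts}
    (h : TermWalkData (place c 𝒲 P.window) w) (hr : ‖P.r‖ ≤ 1) : TermWalkData (place c 𝒲 P) w := by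
  rw [place_eq_pullback]
  exact termWalkData_pullback_of_opNorm_le h P.r hr

/-- The entries at a window placement are the window entries themselves (`r = id`). [cite: Balaban1987RG1, (1.7) p.261] -/
theorem entries_place_window (𝒲 : WindowKernels J V) (P : Placement 𝒲 d N' ν Nf W) (σ : TPt d N' → ℂ) (v : V) :
    entries (place c 𝒲 P.window) σ v = wentries 𝒲 (fun j => σ (P.ιJ j)) v := rfl

end Place

/-! ## §3 Across the tori of the exhausting sequence: the identity is definitional; one local factor for every torus -/

section Tower

variable {c : B13.Consts} {d : ℕ} {J : Type} {V : Type*} [NormedAddCommGroup V] [NormedSpace ℂ V]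
variable {N' ν : ℕ → ℕ} {Nf : (n : ℕ) → Fin (ν n) → ℕ} [∀ n i, NeZero (Nf n i)]
variable {W : ℕ → Type*} [∀ n, NormedAddCommGroup (W n)] [∀ n, NormedSpace ℂ (W n)]

/-- **ACROSS-TORI IDENTITY OF THE RESTRICTED ENTRIES, DEFINITIONAL** — P3's (r2∞) factorisation clause for a placed tower:
for placements `P n` of ONE window object on the tori of a sequence and tree parameters `σ n` whose local parts agree
(`σ n ((P n).ιJ j) = τ j`), `entries (place c 𝒲 (P n)) (σ n) u = wentries 𝒲 τ ((P n).r u)` for EVERY `n` and EVERY `u : W n`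
(`Er := wentries 𝒲 τ` on the common index, reindexing `Equiv.refl`). [cite: Balaban1987RG1, (1.7) p.261, (1.21) p.264; Balaban1988RG2Cluster, p.13, (2.14)–(2.16) pp.15–16] -/
theorem entries_place_tower (𝒲 : WindowKernels J V) (P : (n : ℕ) → Placement 𝒲 d (N' n) (ν n) (Nf n) (W n))
    {σ : (n : ℕ) → (TPt d (N' n) → ℂ)} {τ : J → ℂ} (hσ : ∀ n j, σ n ((P n).ιJ j) = τ j) (n : ℕ) (u : W n) :
    entries (place c 𝒲 (P n)) (σ n) u = wentries 𝒲 τ ((P n).r u) := by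
  rw [entries_place, show (fun j => σ n ((P n).ιJ j)) = τ from funext (hσ n)]

/-- The same, entry by entry, in the literal shape of the (r2∞) clause (`∀ n`, `∀ u`, no ball, no reindexing).
[cite: Balaban1987RG1, (1.7) p.261, (1.21) p.264] -/
theorem entries_place_tower_apply (𝒲 : WindowKernels J V) (P : (n : ℕ) → Placement 𝒲 d (N' n) (ν n) (Nf n) (W n))
    {σ : (n : ℕ) → (TPt d (N' n) → ℂ)} {τ : J → ℂ} (hσ : ∀ n j, σ n ((P n).ιJ j) = τ j) (n : ℕ) (u : W n)
    (i : (𝒲.Λ × (𝒲.Λ ⊕ 𝒲.C₀)) ⊕ (𝒲.Λ × 𝒲.Λ)) :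
    entries (place c 𝒲 (P n)) (σ n) u i = wentries 𝒲 τ ((P n).r u) i := by
  rw [entries_place_tower 𝒲 P hσ n u]

/-- **The holomorphy ∕ bound letter from the walk objects AT ONE WINDOW PLACEMENT** (any one torus's bookkeeping
`(N'₀, ν₀, Nf₀)`, `r = id`): `TermWalkData (place c 𝒲 P₀.window) w` with `ε, κ, K̄_Γ, K̄_E ≥ 0` and a polydisc parameter
`σ₀` with local part `τ` give `HolBddOn 𝒲 τ w.R (max K̄_Γ K̄_E)` (`B13TermKernelsPullback.termWalkData_differentiableOn_entries`
∕ `termWalkData_norm_entries_le`). [cite: Balaban1988RG2Cluster, p.13, p.15; Balaban1985BackgroundPropagators, Thm 3.10 p.416] -/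
theorem holBddOn_of_termWalkData {N'₀ ν₀ : ℕ} {Nf₀ : Fin ν₀ → ℕ} [∀ i, NeZero (Nf₀ i)]
    {W₀ : Type*} [NormedAddCommGroup W₀] [NormedSpace ℂ W₀]
    (𝒲 : WindowKernels J V) (P₀ : Placement 𝒲 d N'₀ ν₀ Nf₀ W₀) {w : WalkConsts}
    (h : TermWalkData (place c 𝒲 P₀.window) w) (hε : 0 ≤ w.ε) (hkap : 0 ≤ w.kap) (hKΓ : 0 ≤ w.KbarΓ)
    (hKE : 0 ≤ w.KbarE) {σ₀ : TPt d N'₀ → ℂ} (hσ₀ : ∀ j, ‖σ₀ j‖ ≤ Real.exp c.κ₁) {τ : J → ℂ}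
    (hτ : ∀ j, σ₀ (P₀.ιJ j) = τ j) :
    HolBddOn 𝒲 τ w.R (max w.KbarΓ w.KbarE) := by
  have hEr := termWalkData_differentiableOn_entries h hε hσ₀
  have hbd := termWalkData_norm_entries_le h hε hkap hKΓ hKE hσ₀
  have e : ∀ v : V, entries (place c 𝒲 P₀.window) σ₀ v = wentries 𝒲 τ v := fun v => by
    rw [entries_place_window, show (fun j => σ₀ (P₀.ιJ j)) = τ from funext hτ]
  refine ⟨fun i => (hEr i).congr fun v _ => ?_, fun i v hv => ?_⟩
  · rw [← e v]
  · rw [← e v]; exact hbd i v hv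

/-- **ONE LOCAL FACTOR FOR EVERY TORUS — the wall shapes across the sequence for a placed tower.**  From the torus-free letter
`HolBddOn 𝒲 τ R S` (`R > 0`; `V` finite-dimensional, `C₀` finite) and ONE function `Φ` of the entries holomorphic on an open
set containing `wentries 𝒲 τ 0`: there is ONE `F : V → T`, analytic at `0`, with
`Φ (entries (kjet (place c 𝒲 (P n))) (σ n) u) = F ((P n).r u)` for EVERY `n` and EVERY `u : W n` — the conclusion of P3's
`wallShapes_tower` (the `(V Y, F Y, r n Y, hF, hfac)` fields of `Beta.RemainderLocality.PolLeavesTFac` for the jet objects), `∀ n`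
in place of `∀ᶠ n`, with the explicit witness `F = Φ ∘ (v ↦ (jet2 (wentries 𝒲 τ · i) v)_i)` (`B13JetFamilyLocality.entries_kjet_fac`
per torus + `analyticAt_jetFactor` once). [cite: Balaban1987RG1, (1.7) p.261, (1.18) p.263, (1.21)–(1.22) p.264, (4.3)–(4.5) pp.281–282; Balaban1988RG2Cluster, p.13, (2.14)–(2.16) pp.15–16] -/
theorem wallShapes_tower_place [FiniteDimensional ℂ V] (𝒲 : WindowKernels J V) [Fintype 𝒲.C₀]
    (P : (n : ℕ) → Placement 𝒲 d (N' n) (ν n) (Nf n) (W n)) {σ : (n : ℕ) → (TPt d (N' n) → ℂ)} {τ : J → ℂ}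
    (hσ : ∀ n j, σ n ((P n).ιJ j) = τ j) {R S : ℝ} (hR : 0 < R) (hW : HolBddOn 𝒲 τ R S)
    {T : Type*} [NormedAddCommGroup T] [NormedSpace ℂ T] [CompleteSpace T]
    {Φ : (((𝒲.Λ × (𝒲.Λ ⊕ 𝒲.C₀)) ⊕ (𝒲.Λ × 𝒲.Λ)) → ℂ) → T}
    {U : Set (((𝒲.Λ × (𝒲.Λ ⊕ 𝒲.C₀)) ⊕ (𝒲.Λ × 𝒲.Λ)) → ℂ)} (hU : IsOpen U) (hΦ : DifferentiableOn ℂ Φ U)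
    (h0 : wentries 𝒲 τ 0 ∈ U) :
    ∃ F : V → T, AnalyticAt ℂ F 0 ∧
      ∀ n (u : W n), Φ (entries (kjet (place c 𝒲 (P n))) (σ n) u) = F ((P n).r u) := by
  haveI : Fintype 𝒲.Λ := 𝒲.instFintype
  refine ⟨Φ ∘ fun v i => jet2 (fun v' => wentries 𝒲 τ v' i) v, analyticAt_jetFactor hR hW.1 hW.2 hU hΦ h0,
    fun n u => ?_⟩
  have hfac : ∀ u ∈ ball (0 : W n) R, entries (place c 𝒲 (P n)) (σ n) u = wentries 𝒲 τ ((P n).r u) :=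
    fun u _ => entries_place_tower 𝒲 P hσ n u
  rw [entries_kjet_fac (place c 𝒲 (P n)) (σ n) (P n).r hR hR (Er := wentries 𝒲 τ) hW.1 hfac u]
  rfl

/-- **The same from the walk objects at one window placement with an admissible package** (the letter supplied by
`holBddOn_of_termWalkData`; `0 ≤ α < w.R`). [cite: Balaban1987RG1, (1.7) p.261, (1.18) p.263, (1.21) p.264; Balaban1988RG2Cluster, p.13, p.15; Balaban1985BackgroundPropagators, Thm 3.10 p.416] -/
theorem wallShapes_tower_place_of_termWalkData [FiniteDimensional ℂ V] (𝒲 : WindowKernels J V) [Fintype 𝒲.C₀]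
    {N'₀ ν₀ : ℕ} {Nf₀ : Fin ν₀ → ℕ} [∀ i, NeZero (Nf₀ i)] {W₀ : Type*} [NormedAddCommGroup W₀] [NormedSpace ℂ W₀]
    (P₀ : Placement 𝒲 d N'₀ ν₀ Nf₀ W₀) {w : WalkConsts} {α Rσ₀ : ℝ} (hw : w.Admissible α Rσ₀) (hα : 0 ≤ α)
    (h : TermWalkData (place c 𝒲 P₀.window) w) {σ₀ : TPt d N'₀ → ℂ} (hσ₀ : ∀ j, ‖σ₀ j‖ ≤ Real.exp c.κ₁)
    {τ : J → ℂ} (hτ : ∀ j, σ₀ (P₀.ιJ j) = τ j)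
    (P : (n : ℕ) → Placement 𝒲 d (N' n) (ν n) (Nf n) (W n)) {σ : (n : ℕ) → (TPt d (N' n) → ℂ)}
    (hσ : ∀ n j, σ n ((P n).ιJ j) = τ j)
    {T : Type*} [NormedAddCommGroup T] [NormedSpace ℂ T] [CompleteSpace T]
    {Φ : (((𝒲.Λ × (𝒲.Λ ⊕ 𝒲.C₀)) ⊕ (𝒲.Λ × 𝒲.Λ)) → ℂ) → T}
    {U : Set (((𝒲.Λ × (𝒲.Λ ⊕ 𝒲.C₀)) ⊕ (𝒲.Λ × 𝒲.Λ)) → ℂ)} (hU : IsOpen U) (hΦ : DifferentiableOn ℂ Φ U)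
    (h0 : wentries 𝒲 τ 0 ∈ U) :
    ∃ F : V → T, AnalyticAt ℂ F 0 ∧
      ∀ n (u : W n), Φ (entries (kjet (place c 𝒲 (P n))) (σ n) u) = F ((P n).r u) :=
  wallShapes_tower_place 𝒲 P hσ (hα.trans_lt hw.hαR)
    (holBddOn_of_termWalkData 𝒲 P₀ h hw.hε hw.hkap.le hw.hKbarΓ hw.hKbarE hσ₀ hτ) hU hΦ h0

/-- **The TRUE objects of a placed tower factor through the restrictions with ONE torus-independent factor**, for every
`n` and `u` (definitional) — the true-object road's (1.7)∕(1.21) across tori. [cite: Balaban1987RG1, (1.7) p.261, (1.21) p.264] -/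
theorem trueObject_fac_tower_place (𝒲 : WindowKernels J V) (P : (n : ℕ) → Placement 𝒲 d (N' n) (ν n) (Nf n) (W n))
    {σ : (n : ℕ) → (TPt d (N' n) → ℂ)} {τ : J → ℂ} (hσ : ∀ n j, σ n ((P n).ιJ j) = τ j)
    {T : Type*} (Φ : (((𝒲.Λ × (𝒲.Λ ⊕ 𝒲.C₀)) ⊕ (𝒲.Λ × 𝒲.Λ)) → ℂ) → T) (n : ℕ) (u : W n) :
    Φ (entries (place c 𝒲 (P n)) (σ n) u) = (Φ ∘ wentries 𝒲 τ) ((P n).r u) := by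
  rw [entries_place_tower 𝒲 P hσ n u]; rfl

end Tower

end Literature.MathematicalPhysics.QuantumFieldTheory.Balaban1983to89.B13WindowKernels

end
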